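import Summits.CriticalPhenomena.CardyFormulaZ2.Theses.CardySelfRefinement
import Summits.CriticalPhenomena.CardyFormulaZ2.Theorems.CardySelfRefinementScaleInvariantLimitsStubScaleInvariantLimitsOfLags
import Literature.Probability.Percolation.QuadCrossingSpaceZ2
import Literature.Probability.Percolation.QuadCrossingSpaceProofs
import Literature.Probability.Percolation.QuadCrossingCrossedEventInterior
import HarnessLib

/-!
# `TwoLagsAllLags` (route CardySelfRefinement, item stmt-CriticalPhenomena-10274)

Card P3 in limit form: **if every subsequential scaling limit `μ` of the critical bond-`ℤ²`
quad-crossing laws is invariant under `S_2` and `S_3`, then it is invariant under every `S_t`,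
`t > 0`** (`ScaleInvariantLimits`).  Proof as filed by the planner:

* the (logarithmic) stabiliser `H_μ = {x : S_{eˣ} μ = μ}` is an additive subgroup of `ℝ`
  (`S_1 = id`, `S_s S_t = S_{st}`: `dilateLaw_one_eq`, `dilateLaw_dilateLaw_eq`, landed for line
  `Sketch` of the crux `ScaleInvariantLimits`);
* it is CLOSED: `x ↦ S_{eˣ} μ` is continuous (`continuous_dilateLaw_exp`), because the dilation action
  on `ℋ_ℂ` is continuous in the scale parameter at `1` pointwise
  (`QuadConfig.tendsto_mapHomeomorph_of_tendstoUniformlyOn`, Literature) and dominated convergence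
  passes this to laws (`tendsto_dilateLaw_of_tendsto_one`, adapted from the crux disprover's
  `Cruxes/ScaleInvariantLimits/Disproof.lean` §8), while weak limits of finite measures on the
  metrizable `ℋ_ℂ` (Schramm–Smirnov Thm 1.4, proved in the tree) are unique;
* it contains `log 2` and `log 3`, and `log 2 / log 3 ∉ ℚ` (`2ⁿ = 3ᵐ` is impossible for `n ≥ 1`
  by parity), so it is not cyclic, hence dense (Mathlib `AddSubgroup.dense_or_cyclic`), hence
  — being closed — all of `ℝ`.
-/

noncomputable section

open MeasureTheory Filter Set Topology
open Literature.Probability.Percolation Literature.Probability.Percolation.QuadCrossing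
open Summit.CriticalPhenomena.CardyFormulaZ2.Theses.CardySelfRefinement

namespace Summit.CriticalPhenomena.CardyFormulaZ2.Theorems

/-! ### Weak continuity of the dilation action in the scale parameter -/

-- adapted from Cruxes/ScaleInvariantLimits/Disproof.lean §8 (`tendstoUniformlyOn_mul_of_tendsto_one`)
/-- Dilations `z ↦ c z` converge to the identity uniformly on compact sets as `c → 1`. -/
theorem tendstoUniformlyOn_mul_of_tendsto_one' {ι : Type*} {l : Filter ι} {c : ι → ℂ}
    (hc : Tendsto c l (𝓝 1)) {K : Set ℂ} (hK : IsCompact K) :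
    TendstoUniformlyOn (fun i z => c i * z) id l K := by
  obtain ⟨R, hR⟩ := hK.isBounded.subset_closedBall 0
  rw [Metric.tendstoUniformlyOn_iff]
  intro ε hε
  have hR1 : 0 < max R 1 := lt_of_lt_of_le zero_lt_one (le_max_right _ _)
  have hev : ∀ᶠ i in l, dist (c i) 1 < ε / max R 1 :=
    (Metric.tendsto_nhds.mp hc) _ (div_pos hε hR1)
  filter_upwards [hev] with i hi z hz
  have hzR : ‖z‖ ≤ max R 1 := (mem_closedBall_zero_iff.mp (hR hz)).trans (le_max_left _ _)
  rw [dist_comm, dist_eq_norm, show c i * z - id z = (c i - 1) * z by simp [sub_mul], norm_mul]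
  rw [dist_eq_norm] at hi
  calc ‖c i - 1‖ * ‖z‖ ≤ ‖c i - 1‖ * max R 1 := mul_le_mul_of_nonneg_left hzR (norm_nonneg _)
    _ < ε / max R 1 * max R 1 := mul_lt_mul_of_pos_right hi hR1
    _ = ε := div_mul_cancel₀ ε hR1.ne'

-- adapted from Cruxes/ScaleInvariantLimits/Disproof.lean §8 (`tendsto_map_mulLeft_of_tendsto_one`)
/-- **Weak continuity of `t ↦ S_t μ` at `t = 1`**: if `c i → 1` (non-zero real scale factors)
then `dilateLaw (c i) μ → μ` weakly, for every finite law `μ` on `ℋ_ℂ` (pointwise continuity of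
the action on `ℋ_ℂ`, `QuadConfig.tendsto_mapHomeomorph_of_tendstoUniformlyOn`, and dominated
convergence). -/
theorem tendsto_dilateLaw_of_tendsto_one {ι : Type*} {l : Filter ι} [l.IsCountablyGenerated]
    {c : ι → ℝ} (hc0 : ∀ i, c i ≠ 0) (hc : Tendsto c l (𝓝 1))
    (μ : FiniteMeasure (QuadConfig (univ : Set ℂ))) :
    Tendsto (fun i => dilateLaw (c i) (hc0 i) μ) l (𝓝 μ) := by
  have hc0' : ∀ i, (c i : ℂ) ≠ 0 := fun i => Complex.ofReal_ne_zero.mpr (hc0 i)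
  have hcC : Tendsto (fun i => (c i : ℂ)) l (𝓝 1) := by
    have h := (Complex.continuous_ofReal.tendsto 1).comp hc
    rw [Complex.ofReal_one] at h
    exact h
  have hpt : ∀ S : QuadConfig (univ : Set ℂ),
      Tendsto (fun i => QuadConfig.dilate (c i) (hc0 i) S) l (𝓝 S) := by
    intro S
    refine QuadConfig.tendsto_mapHomeomorph_of_tendstoUniformlyOn
      (fun i => Homeomorph.mulLeft₀ (c i : ℂ) (hc0' i)) (fun K hK => ?_) (fun K hK => ?_) S
    · simpa [Homeomorph.coe_mulLeft₀] using tendstoUniformlyOn_mul_of_tendsto_one' hcC hK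
    · have hc' : Tendsto (fun i => (c i : ℂ)⁻¹) l (𝓝 1) := by simpa using hcC.inv₀ one_ne_zero
      refine (tendstoUniformlyOn_mul_of_tendsto_one' hc' hK).congr (Eventually.of_forall fun i => ?_)
      intro z _
      simp [Homeomorph.mulLeft₀_symm_apply]
  have hcont : ∀ i, Continuous (QuadConfig.dilate (c i) (hc0 i)) := fun i =>
    QuadConfig.continuous_mapHomeomorph _
  rw [FiniteMeasure.tendsto_iff_forall_integral_tendsto]
  intro f
  have hint : ∀ i, ∫ S, f S ∂((dilateLaw (c i) (hc0 i) μ : FiniteMeasure (QuadConfig (univ : Set ℂ))) :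
      Measure (QuadConfig (univ : Set ℂ))) =
      ∫ S, f (QuadConfig.dilate (c i) (hc0 i) S) ∂(μ : Measure (QuadConfig (univ : Set ℂ))) :=
    fun i => by
    rw [dilateLaw, FiniteMeasure.toMeasure_map,
      integral_map (QuadConfig.measurable_dilate (c i) (hc0 i)).aemeasurable
        f.continuous.aestronglyMeasurable]
  simp_rw [hint]
  refine tendsto_integral_filter_of_dominated_convergence (fun _ => ‖f‖) ?_ ?_ ?_ ?_
  · exact Eventually.of_forall fun i => (f.continuous.comp (hcont i)).aestronglyMeasurable
  · exact Eventually.of_forall fun i => ae_of_all _ fun S => f.norm_coe_le_norm _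
  · exact integrable_const _
  · exact ae_of_all _ fun S => (f.continuous.tendsto S).comp (hpt S)

/-- **`x ↦ S_{eˣ} μ` is continuous** from `ℝ` to the finite laws on `ℋ_ℂ` (weak topology):
`S_{e^y} μ = S_{e^{y-x}} (S_{eˣ} μ)` and `e^{y-x} → 1` as `y → x`. -/
theorem continuous_dilateLaw_exp (μ : FiniteMeasure (QuadConfig (univ : Set ℂ))) :
    Continuous fun x : ℝ => dilateLaw (Real.exp x) (Real.exp_pos x).ne' μ := by
  refine continuous_iff_continuousAt.mpr fun x => ?_
  have h1 : Tendsto (fun y : ℝ => Real.exp (y - x)) (𝓝 x) (𝓝 1) := by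
    have : Tendsto (fun y : ℝ => y - x) (𝓝 x) (𝓝 0) := by
      simpa using (tendsto_id (x := 𝓝 x)).sub_const x
    have h := (Real.continuous_exp.tendsto 0).comp this
    rw [Real.exp_zero] at h
    exact h
  have h := tendsto_dilateLaw_of_tendsto_one (fun y => (Real.exp_pos (y - x)).ne') h1
    (dilateLaw (Real.exp x) (Real.exp_pos x).ne' μ)
  refine h.congr fun y => ?_
  rw [dilateLaw_dilateLaw_eq]
  exact dilateLaw_congr_scale _ _ (by rw [← Real.exp_add, sub_add_cancel]) μ

/-! ### `log 2 / log 3` is irrational -/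

/-- `n · log 2 = m · log 3` with integers `n, m` forces `n = 0` (parity of `2ⁿ = 3ᵐ`). -/
theorem int_mul_log_two_eq_int_mul_log_three {n m : ℤ}
    (h : (n : ℝ) * Real.log 2 = (m : ℝ) * Real.log 3) : n = 0 := by
  have hl2 : 0 < Real.log 2 := Real.log_pos (by norm_num)
  have hl3 : 0 < Real.log 3 := Real.log_pos (by norm_num)
  -- reduce to natural numbers `N ≥ 1`, `M` with `N log 2 = M log 3`
  by_contra hn
  obtain ⟨N, M, hN, hNM⟩ : ∃ N M : ℕ, 0 < N ∧ (N : ℝ) * Real.log 2 = (M : ℝ) * Real.log 3 := by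
    rcases lt_or_gt_of_ne hn with hneg | hpos
    · -- both negative: negate
      have hm : m < 0 := by
        by_contra hm
        push Not at hm
        have h1 : (n : ℝ) * Real.log 2 < 0 := mul_neg_of_neg_of_pos (by exact_mod_cast hneg) hl2
        have h2 : 0 ≤ (m : ℝ) * Real.log 3 := mul_nonneg (by exact_mod_cast hm) hl3.le
        linarith
      refine ⟨(-n).toNat, (-m).toNat, by omega, ?_⟩
      have e1 : (((-n).toNat : ℕ) : ℝ) = -(n : ℝ) := by
        rw [show (((-n).toNat : ℕ) : ℝ) = (((-n).toNat : ℤ) : ℝ) by norm_cast,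
          Int.toNat_of_nonneg (by omega)]; push_cast; ring
      have e2 : (((-m).toNat : ℕ) : ℝ) = -(m : ℝ) := by
        rw [show (((-m).toNat : ℕ) : ℝ) = (((-m).toNat : ℤ) : ℝ) by norm_cast,
          Int.toNat_of_nonneg (by omega)]; push_cast; ring
      rw [e1, e2]; linarith
    · have hm : 0 < m := by
        by_contra hm
        push Not at hm
        have h1 : 0 < (n : ℝ) * Real.log 2 := mul_pos (by exact_mod_cast hpos) hl2
        have h2 : (m : ℝ) * Real.log 3 ≤ 0 := mul_nonpos_of_nonpos_of_nonneg (by exact_mod_cast hm) hl3.le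
        linarith
      refine ⟨n.toNat, m.toNat, by omega, ?_⟩
      have e1 : ((n.toNat : ℕ) : ℝ) = (n : ℝ) := by
        rw [show ((n.toNat : ℕ) : ℝ) = ((n.toNat : ℤ) : ℝ) by norm_cast, Int.toNat_of_nonneg hpos.le]
      have e2 : ((m.toNat : ℕ) : ℝ) = (m : ℝ) := by
        rw [show ((m.toNat : ℕ) : ℝ) = ((m.toNat : ℤ) : ℝ) by norm_cast, Int.toNat_of_nonneg hm.le]
      rw [e1, e2]; exact h
  -- `2^N = 3^M` as reals, then as naturals
  have hR : (2 : ℝ) ^ N = (3 : ℝ) ^ M := by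
    have : Real.log ((2 : ℝ) ^ N) = Real.log ((3 : ℝ) ^ M) := by
      rw [Real.log_pow, Real.log_pow, hNM]
    exact Real.log_injOn_pos (Set.mem_Ioi.mpr (by positivity)) (Set.mem_Ioi.mpr (by positivity)) this
  have hNat : (2 : ℕ) ^ N = 3 ^ M := by exact_mod_cast hR
  have hE : Even ((2 : ℕ) ^ N) := (Nat.even_pow' hN.ne').mpr even_two
  have hO : Odd ((3 : ℕ) ^ M) := (by decide : Odd 3).pow
  rw [hNat] at hE
  exact (Nat.not_even_iff_odd.mpr hO) hE

/-! ### The route item -/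

/-- **`TwoLagsAllLags` (item stmt-CriticalPhenomena-10274 of route CardySelfRefinement).**  If
every subsequential scaling limit `μ ∈ subseqQuadLimits univ` of the critical bond-`ℤ²`
quad-crossing laws satisfies `dilateLaw 2 μ = μ` and `dilateLaw 3 μ = μ`, then `dilateLaw t μ = μ`
for every `t > 0` (`ScaleInvariantLimits`): the logarithmic stabiliser of `μ` is a closed additive
subgroup of `ℝ` containing `log 2` and `log 3`, not cyclic since `log 2 / log 3 ∉ ℚ`, hence dense
(`AddSubgroup.dense_or_cyclic`), hence everything. -/
theorem twoLagsAllLags_proof : TwoLagsAllLags := by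
  intro h23 μ hμ t ht
  obtain ⟨h2, h3⟩ := h23 μ hμ
  -- uniqueness of weak limits on the metrizable `ℋ_ℂ` (Schramm–Smirnov Thm 1.4)
  haveI : TopologicalSpace.MetrizableSpace (QuadConfig (univ : Set ℂ)) :=
    (SchrammSmirnov2011_thm_1_4_holds univ isOpen_univ univ_nonempty).1.2.1
  haveI : HasOuterApproxClosed (QuadConfig (univ : Set ℂ)) := inferInstance
  -- the logarithmic stabiliser
  let Φ : ℝ → FiniteMeasure (QuadConfig (univ : Set ℂ)) := fun x =>
    dilateLaw (Real.exp x) (Real.exp_pos x).ne' μ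
  have hΦ : ∀ x, Φ x = dilateLaw (Real.exp x) (Real.exp_pos x).ne' μ := fun _ => rfl
  let H : AddSubgroup ℝ :=
    { carrier := {x | Φ x = μ}
      add_mem' := by
        intro x y hx hy
        simp only [mem_setOf_eq, hΦ] at hx hy ⊢
        rw [← dilateLaw_congr_scale (mul_ne_zero (Real.exp_pos x).ne' (Real.exp_pos y).ne') _
          (Real.exp_add x y).symm μ,
          ← dilateLaw_dilateLaw_eq (Real.exp x) (Real.exp y) (Real.exp_pos x).ne' (Real.exp_pos y).ne' μ,
          hy, hx]
      zero_mem' := by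
        simp only [mem_setOf_eq, hΦ]
        rw [dilateLaw_congr_scale _ one_ne_zero Real.exp_zero μ]
        exact dilateLaw_one_eq μ
      neg_mem' := by
        intro x hx
        simp only [mem_setOf_eq, hΦ] at hx ⊢
        conv_lhs => rw [← hx]
        rw [dilateLaw_dilateLaw_eq,
          dilateLaw_congr_scale _ one_ne_zero (by rw [← Real.exp_add, neg_add_cancel, Real.exp_zero]) μ]
        exact dilateLaw_one_eq μ }
  have hmem : ∀ {x : ℝ}, x ∈ H ↔ dilateLaw (Real.exp x) (Real.exp_pos x).ne' μ = μ :=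
    fun {x} => Iff.rfl
  -- closed
  have hclosed : IsClosed (H : Set ℝ) :=
    isClosed_eq (continuous_dilateLaw_exp μ) continuous_const
  -- contains `log 2`, `log 3`
  have hlog2 : Real.log 2 ∈ H := by
    rw [hmem, dilateLaw_congr_scale _ two_ne_zero (Real.exp_log two_pos) μ]; exact h2
  have hlog3 : Real.log 3 ∈ H := by
    rw [hmem, dilateLaw_congr_scale _ three_ne_zero (Real.exp_log three_pos) μ]; exact h3
  -- dense (not cyclic)
  have hdense : Dense (H : Set ℝ) := by
    rcases AddSubgroup.dense_or_cyclic H with hd | ⟨a, ha⟩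
    · exact hd
    · exfalso
      rw [ha, AddSubgroup.mem_closure_singleton] at hlog2 hlog3
      obtain ⟨m, hm⟩ := hlog2
      obtain ⟨n, hn⟩ := hlog3
      have key : (n : ℝ) * Real.log 2 = (m : ℝ) * Real.log 3 := by
        rw [← hm, ← hn, zsmul_eq_mul, zsmul_eq_mul]; ring
      have hn0 : n = 0 := int_mul_log_two_eq_int_mul_log_three key
      rw [hn0, zero_zsmul] at hn
      exact (Real.log_pos (by norm_num : (1 : ℝ) < 3)).ne' hn.symm
  -- hence everything
  have hall : (H : Set ℝ) = univ := by
    rw [← hclosed.closure_eq]; exact hdense.closure_eq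
  have hlogt : Real.log t ∈ H := by
    rw [← SetLike.mem_coe, hall]; exact mem_univ _
  rw [hmem, dilateLaw_congr_scale _ ht.ne' (Real.exp_log ht) μ] at hlogt
  exact hlogt

end Summit.CriticalPhenomena.CardyFormulaZ2.Theorems

end
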